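import Literature.MathematicalPhysics.QuantumFieldTheory.Balaban1983to89.B11

/-!
# `Balaban1983to89.B11Prop7Assembly` — T. Bałaban, *The variational problem and background fields in renormalization group method
# for lattice gauge theories*, Commun. Math. Phys. **102** (1985) 277–309 [Balaban1985Variational], **Proposition 7** (p. 299) ASSEMBLED
# from Propositions 2, 5, 6 BY NAME: clause (i) «at most one critical orbit» = the p. 296 argument (122) over the typed statements of record
# `B11.Prop2Printed ∧ B11.Prop5Printed ∧ B11.Prop6Printed` + the p. 280 axial-gauge reduction (16)–(18); clause (ii) «there exists a minimal
# orbit … with ε₀ = O(1)C₁B₃ε₁» = Prop. 6 + the located steps of pp. 296–299, constants explicit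

statement-level skeleton of published theorems with citation tags; proofs where landed; nothing here is a claim about the Yang–Mills mass gap

PDF held: `paper:balaban1985-cmp102-variational-background` (journal page = PDF page + 276); pp. 280, 281, 296, 299 [PDF 4, 5, 20, 23] read
as images by this seat (renders `run/shared/lean/pub/pub-balaban/b2b-balaban-ref1/pages/1985-cmp102-variational-background/…-p0NN-x2.png`).

CITATION HEADER (lean-in-tree rule 2026-08-18).  WHAT IS REPRODUCED: SKELETON row `B11.Prop7` (reader r08 `ROWS-B11.md`; decl of record
`B11.Prop7Printed B₃ C₁ fam`, B11.lean, typed-existing over the Theorem-1 carrier `B11.VarProblemX`; reductions of record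
`B11.thm1_of_prop7_prop8_sectF` (Thm 1 ⇐ Prop 7 ∧ Prop 8 ∧ Sect. F), `B11Thm1.Prop7From14` / `prop7Printed_of_from14` (the background-dependent
form), `B11.axial_critical_from_one_landau` (uniqueness in the Landau gauge ⇐ Props 2, 5, 6 over the Sect. A–E carrier `B11.LGData`)).
THIS FILE closes the remaining link of the paper-internal proof DAG of row B11.Prop7: from the `LGData`-level conclusion to the
`VarProblemX`-level statement, through a BRIDGE between the two carriers whose laws are the located sentences of p. 280/281.

THE PRINT.  p. 299 [PDF 23], verbatim: *"Proposition 7. There exist positive, absolute constants a₀, a′₁ such that for ε₀ ≦ a₀ and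
B₃ε₁ ≦ ε₀ the variational problem (5), (6) has at most one critical orbit. If ε₁ ≦ a′₁, then there exists a minimal orbit in the space (6)
with ε₀ = O(1)C₁B₃ε₁."*  THE PRINTED PROOF OF CLAUSE (i), p. 296 [PDF 20], verbatim: *"Now let us draw some conclusions concerning the basic
variational problems (5), (19)–(21), and (5), (6). Let us consider the first problem. If we take ε₄ = 8ε₂, and if we assume 8ε₂ ≦ a₄ and
2B₀C₁B₃ε₁ ≦ 8ε₂, then by Propositions 5 and 6 there is at most one critical configuration of (5) in (19)–(21). We get the same conclusion
for the second problem if we take ε₂ = B₁(ε₀ + C₁ε₁) and assume the above restrictions. To get simpler formulations let us take ε₂ = B₁ε₀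
+ 5dLB₀C₁B₃ε₁ (we have B₁ = 5dLB₀), then the second condition above is satisfied automatically. The first condition gives restrictions on
ε₀, ε₁. To simplify them let us use the assumption B₃ε₁ ≦ ε₀. We have 8ε₂ ≦ 8B₁ε₀ + 8B₁C₁ε₀ ≦ 16B₁C₁ε₀, (122) thus if B₃ε₁ ≦ ε₀ and
16B₁C₁ε₀ ≦ a₄, then the functional (5) has at most one critical orbit in the space (6)."*  The passage from «(19)–(21)» to «the space
(6)» is Proposition 2 (p. 281) together with p. 280 [PDF 4], verbatim: *"A gauge transformation u applied to U implements the following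
transformation of U′^u(x, x′) = u(x)U′(x, x′)R(U₀(x, x′))u^{−1}(x′), (16) if U₀ is fixed in the representation (15). … Now we choose a gauge
in the space (6). Using the transformations (16) with u satisfying (4) we fix the axial gauge conditions Ax_k(𝔅_k, U₀) (see the definition
(1.19) in [6]). The functional (5) is gauge invariant, hence it is enough to consider it on the space 𝔘_k({Ω_j}, ε₀) ∩ 𝔅_k(𝔅_k, V) ∩
Ax_k(𝔅_k, U₀). (18)"*  THE PRINTED PROOF OF CLAUSE (ii), p. 296: *"Equation (111) has a solution belonging to the space (115) with ε₄ =
2B₀C₁B₃ε₁, if 2B₀C₁B₃ε₁ ≦ a₄. This solution determines a critical configuration U₁ by the transformation (112) …"*, pp. 296–299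
(123)–(140) ending *"Thus the transformation (47) applied to A′₁ yields the configuration A′₁ − HD(A′₁) = 1/iη log U₁ satisfying all the
conditions (19)–(21) with ε₂ = O(1)C₁B₃ε₁, where O(1) is an absolute constant depending on d and L only. Now we take the configuration U₁U₀
and we apply to it a gauge transformation u satisfying the conditions \overline{R₀u}^j = 1 on Λ_j, and such that the gauge transformed
configuration (U₁U₀)^u satisfies the axial gauge conditions Ax_k(𝔅_k, U₀). Let us define U_k = (U₁U₀)^u. Proposition 7 [6] implies that
U_k belongs to the space (18) with ε₀ = O(1)C₁B₃ε₁. It is a critical configuration of the functional (5). To see that U_k is a minimum …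
[(141)–(142)] … Hence A′ = 0 is a minimum of the functional (143) and this implies that U_k is a minimal configuration of the functional
A(U)."* ([6] = [Balaban1985RegularSpaces], its Prop. 7 = tree `B8.Prop7Printed`; the analytic core of the minimality step is proved on the
abstract chart in the sibling `B11Eq142LocalMin`.)

WHAT IS CERTIFIED (kernel, sorry-free; axioms `propext` / `Classical.choice` / `Quot.sound`).
§1 `Bridge`, `Bridge.Laws`: the dictionary between the Theorem-1 carrier `B11.VarProblemX` (configurations U, orbits, criticality of (5))
   and the Sect. A–E carrier `B11.LGData` (background U₀, perturbations U′/U₁, gauge transformations u) — (15) `emb U₀ U′ = U′U₀`, the boundary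
   datum read on both sides (`bdry`); laws = the p. 280 reduction to (18) (`gaugeFix`), the orbit content of (16) (`orbit16`), and that
   «lie on one orbit of the group (4)» is symmetric and transitive.
§2 `one_landau_of_props`: `B11.axial_critical_from_one_landau` RE-PROVED with the printed INEQUALITY `B₁(ε₀ + C₁ε₁) ≤ ε₂` in place of the
   tree lemma's equality (the printed «simpler formulation» ε₂ = B₁ε₀ + 5dLB₀C₁B₃ε₁ is larger than B₁(ε₀ + C₁ε₁)).
§3 `ineq122_le` & co.: the constants — with ε₂ := B₁ε₀ + B₁C₁B₃ε₁ and a₀ := min{a₄/(16B₁C₁), c₁/(2C₁), c/(8B₁C₁)}, the assumptions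
   B₃ε₁ ≤ ε₀ ≤ a₀ (B₃, C₁ ≥ 1, B₀ ≤ 4B₁) give every smallness condition Props 2, 5, 6 ask for ((122) verbatim = `B11.ineq122`).
§4 **`atMostOneCriticalOrbit_of_props`**: CLAUSE (i) of Proposition 7 — for every bridged family, `Prop2Printed ∧ Prop5Printed ∧
   Prop6Printed` ⇒ ∃ a₀ > 0 (explicit as in §3) such that for 0 < ε₁, B₃ε₁ ≤ ε₀ ≤ a₀, every V and every background U₀ with (14),
   `VarProblemX.AtMostOneCriticalOrbit ε₀ V` («the variational problem (5), (6) has at most one critical orbit»).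
§5 `ExistenceLeaves` + **`exists_minimalOrbit_of_prop6`**: CLAUSE (ii) from `Prop6Printed` and the three located steps of pp. 296–299
   (solution of (111) ↦ critical U₁ in (19)–(21) with ε₂ = O(1)C₁B₃ε₁; axial gauge + [6] Prop. 7 ↦ U_k ∈ (18) critical; (141)–(142) ↦
   minimal), with a′₁ = a₄/(2B₀C₁B₃) and O(1) = O₂·O₁ explicit.
§6 **`prop7From14_of_props`** (both clauses, background-dependent form = the shape of `B11Thm1.Prop7From14`) and **`prop7Printed_of_props`**:
   the typed statement of record `B11.Prop7Printed B₃ C₁ famP` from the above plus the Sect. A law «every V with (7) has a background U₀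
   with (14)» (p. 280 (12)–(14); at level k this is Theorem 1 at level k − 1 — GAPS G-pv12-1, exactly as in `B11Thm1.prop7Printed_of_from14`).

§7 (v1.1, after the model instantiation `B11Prop7Model`) **the minimality leaf with a RADIUS CAP**: `ExistenceLeavesCap β B₀ B₃ C₁ O₁ O₂ e₅`
   = `crit112`, `axial18` unchanged + `minimal142` only for spaces 𝔘(e) with e ≤ e₅ (p. 299 argues minimality for THE configuration U_k in the
   space (6) with ε₀ = O(1)C₁B₃ε₁, small; p. 301 «a sufficiently small neighborhood»); the uncapped law asks EVERY critical configuration of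
   EVERY 𝔘(e) to be minimal, which honest models refute (critical points far from the background), while the capped law holds in the one-norm
   chart model with e₅ = min{a₃/2, γ/(8C₄)}.  `ExistenceLeaves.cap` (old ⇒ capped), **`exists_minimalOrbit_of_prop6_cap`** (a′₁ =
   min{a₄/(2B₀C₁B₃), e₅/(O₂O₁C₁B₃)}), `prop7From14_of_props_cap`, **`prop7Printed_of_props_cap`**, `thm1Printed_of_props_cap`.

HONEST SCOPE — what is NOT claimed.  (i) Propositions 2, 5, 6, [6] Prop. 7, the bounds (123)–(140) and the minimality transfer are INPUTS
(typed statements of record / located leaves with their verbatim sentences); this file is the paper-internal bookkeeping of p. 296 and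
p. 299, not a proof of those inputs (rows B11.Prop2/5/6, B8.Prop7, B11.Eq123–Eq141 carry their own status; model instances:
`B11Prop5Model`, `B11Prop6Model`, `B11Eq142LocalMin`).  (ii) The hypothesis `B₀ ≤ 4B₁` is the printed «(we have B₁ = 5dLB₀), then the second
condition above is satisfied automatically»; `1 ≤ B₃`, `1 ≤ C₁` are printed facts about (162) and C₁ = L³ (`B11.B3_lower_bounds`).  (iii) The two
thresholds c₁/(2C₁) ([6] Thm 2 via Prop. 2: ε₀ + C₁ε₁ ≤ c₁) and c/(8B₁C₁) (Prop. 5: ε₃ = 4ε₂ «sufficiently small») folded into a₀ are the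
«all the previous restrictions» the paper carries silently; a₀ stays (d, L)-dependent («absolute», DIVERGENCE D-B11-3).  (iv) «minimal orbit»
is the carrier's primitive `OnMinimalOrbit` (LOCAL reading as printed, cell GAPS G-B11-E5g).  Mega-formalization `lit-balaban`, HOME
`run/shared/lean/pub/lit-balaban/`, reader/typer seat r08 gen 7 (unit `lit-balaban-r08`).  Imports `B11` only; modifies nothing.  Net new
unproved facts: 0 (two dictionary structures whose Prop-valued laws are hypotheses of the theorems, as `B11.VarProblemX.Laws`).
-/

namespace Literature.MathematicalPhysics.QuantumFieldTheory.Balaban1983to89.B11Prop7Assembly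

open B11

variable {I : Type}

/-! ## §1 The bridge between the Theorem-1 carrier and the Sect. A–E carrier -/

/-- The dictionary between ONE variational problem on the Theorem-1 carrier `P : B11.VarProblemX` (configurations U on Ω₀, boundary data
V, «critical configuration of (5)», «lie on one orbit of the group (4)») and its Sect. A–E description `D : B11.LGData` around backgrounds
U₀: `bdry V` = the same boundary datum V read on the Sect. A–E carrier; `emb U₀ U′ = U′U₀` — the representation (15) «U = U′U₀,
U′ = UU₀⁻¹» of a configuration by its perturbation of the background. [cite: Balaban1985Variational, (15) p.280] -/
structure Bridge (P : VarProblemX) (D : LGData) where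
  bdry : P.Bdry → D.Bdry
  emb : D.Cfg → D.Pert → P.Cfg

/-- The located laws of the bridge, for the backgrounds U₀ of (14) with constants C₁, B₃ (hypotheses of the theorems below, never
asserted).  `gaugeFix` = p. 280: *"Now we choose a gauge in the space (6). Using the transformations (16) with u satisfying (4) we fix
the axial gauge conditions Ax_k(𝔅_k, U₀) (see the definition (1.19) in [6]). The functional (5) is gauge invariant, hence it is enough to
consider it on the space (18)"* — every U in (6) = 𝔘_k(ε₀) ∩ 𝔅_k(V) lies on the orbit of some U′U₀ with U′ in (18), and U critical ⇒ U′U₀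
critical; `orbit16` = (16) p. 280 / p. 281 «transforming them to the axial gauge Ax_k(𝔅_k, U₀) by gauge transformations u»: the axial-gauge
images (U₁U₀)^u, (U₁U₀)^{u′} of ONE configuration U₁U₀ under two restricted gauge transformations lie on one orbit of the group (4);
`symm`, `trans`: «lie on one orbit» is symmetric and transitive. [cite: Balaban1985Variational, (4) p.278, (15)–(18) p.280, Prop. 2 p.281] -/
structure Bridge.Laws {P : VarProblemX} {D : LGData} (β : Bridge P D) (C₁ B₃ : ℝ) : Prop where
  gaugeFix : ∀ (ε₀ ε₁ : ℝ) (V : P.Bdry) (U₀ : D.Cfg) (U : P.Cfg),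
    D.Sat14 (C₁ * B₃ * ε₁) (C₁ * ε₁) (β.bdry V) U₀ → P.InU ε₀ U → P.InB V U →
      ∃ U' : D.Pert, D.In18 ε₀ (β.bdry V) U₀ U' ∧ P.SameOrbit U (β.emb U₀ U') ∧
        (P.IsCritical V U → D.Crit (β.bdry V) U₀ U')
  orbit16 : ∀ (U₀ : D.Cfg) (U₁ : D.Pert) (u u' : D.GT), D.Restricted U₀ u → D.Restricted U₀ u' →
    P.SameOrbit (β.emb U₀ (D.toAxial U₀ U₁ u)) (β.emb U₀ (D.toAxial U₀ U₁ u'))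
  symm : ∀ U U' : P.Cfg, P.SameOrbit U U' → P.SameOrbit U' U
  trans : ∀ U U' U'' : P.Cfg, P.SameOrbit U U' → P.SameOrbit U' U'' → P.SameOrbit U U''

/-! ## §2 Uniqueness in the Landau gauge ⇐ Props 2, 5, 6 (p. 296), with the printed inequality for ε₂ -/

/-- p. 296, verbatim: *"If we take ε₄ = 8ε₂, and if we assume 8ε₂ ≦ a₄ and 2B₀C₁B₃ε₁ ≦ 8ε₂, then by Propositions 5 and 6 there is at most
one critical configuration of (5) in (19)–(21). We get the same conclusion for the second problem if we take ε₂ [≧] B₁(ε₀ + C₁ε₁) and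
assume the above restrictions."* — `B11.axial_critical_from_one_landau` with `B₁(ε₀ + C₁ε₁) ≤ ε₂` (both `Prop2Printed` and `Prop5Printed`
take the inequality; ε₃ = 4ε₂ so that (104) is (115) with ε₄ = 8ε₂): any two critical configurations of the space (18) are
restricted-gauge images of ONE Landau-gauge configuration U₁. [cite: Balaban1985Variational, p.296 before (122)] -/
theorem one_landau_of_props (B₀ B₁ B₃ C₁ c₁ : ℝ) (fam : I → LGData)
    (h2 : Prop2Printed B₁ B₃ C₁ c₁ fam) (h5 : Prop5Printed B₁ B₃ C₁ fam) (h6 : Prop6Printed B₀ B₃ C₁ fam) :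
    ∃ c a₄ : ℝ, 0 < c ∧ 0 < a₄ ∧ ∀ i : I, ∀ ε₀ ε₁ ε₂ : ℝ, 0 < ε₀ → 0 < ε₁ → ε₀ + C₁ * ε₁ ≤ c₁ →
      B₃ * ε₁ ≤ ε₀ → B₁ * (ε₀ + C₁ * ε₁) ≤ ε₂ → 8 * ε₂ ≤ a₄ → 2 * B₀ * C₁ * B₃ * ε₁ ≤ 8 * ε₂ → 4 * ε₂ ≤ c →
      ∀ V : (fam i).Bdry, ∀ U₀ : (fam i).Cfg, (fam i).Sat14 (C₁ * B₃ * ε₁) (C₁ * ε₁) V U₀ →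
        ∀ U' U'' : (fam i).Pert, (fam i).In18 ε₀ V U₀ U' → (fam i).Crit V U₀ U' →
          (fam i).In18 ε₀ V U₀ U'' → (fam i).Crit V U₀ U'' →
            ∃ U₁ : (fam i).Pert, ∃ u u' : (fam i).GT, (fam i).Restricted U₀ u ∧ (fam i).Restricted U₀ u' ∧
              (fam i).toAxial U₀ U₁ u = U' ∧ (fam i).toAxial U₀ U₁ u' = U'' := by
  obtain ⟨c, hc, H5⟩ := h5
  obtain ⟨a₄, ha₄, H6⟩ := h6
  refine ⟨c, a₄, hc, ha₄, ?_⟩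
  intro i ε₀ ε₁ ε₂ hε₀ hε₁ hsum hB₃ hε₂ h8 h2B h4c V U₀ h14 U' U'' hU' hcU' hU'' hcU''
  obtain ⟨u, U₁, hu, h19, hcrit, hax⟩ := h2 i ε₀ ε₁ ε₂ hε₀ hε₁ hsum hε₂ V U₀ h14 U' hU' hcU'
  obtain ⟨u', U₁', hu', h19', hcrit', hax'⟩ := h2 i ε₀ ε₁ ε₂ hε₀ hε₁ hsum hε₂ V U₀ h14 U'' hU'' hcU''
  have hq : ε₂ ≤ 4 * ε₂ / 4 := by linarith
  obtain ⟨A₁, hA₁, hsol, hT⟩ := H5 i ε₀ ε₁ ε₂ (4 * ε₂) hε₁ hB₃ hε₂ hq h4c V U₀ h14 U₁ h19 hcrit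
  obtain ⟨A₁', hA₁', hsol', hT'⟩ := H5 i ε₀ ε₁ ε₂ (4 * ε₂) hε₁ hB₃ hε₂ hq h4c V U₀ h14 U₁' h19' hcrit'
  obtain ⟨⟨A, _, _, _, huniq⟩, _, _⟩ := H6 i ε₁ (8 * ε₂) hε₁ h8 h2B V U₀ h14
  have e1 : A₁ = A := huniq A₁ (by linarith) hsol
  have e2 : A₁' = A := huniq A₁' (by linarith) hsol'
  have hU : U₁' = U₁ := by rw [← hT, ← hT', e1, e2]
  exact ⟨U₁, u, u', hu, hu', hax, hU ▸ hax'⟩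

/-! ## §3 The constants of p. 296: ε₂ = B₁ε₀ + B₁C₁B₃ε₁ and a₀ -/

/-- «To get simpler formulations let us take ε₂ = B₁ε₀ + 5dLB₀C₁B₃ε₁ (we have B₁ = 5dLB₀)» — this ε₂ dominates Prop. 2's B₁(ε₀ + C₁ε₁)
since B₃ ≥ 1 (B₃ of (162), `B11.B3_lower_bounds`). [cite: Balaban1985Variational, p.296 before (122)] -/
theorem eps2_ge_prop2 {B₁ B₃ C₁ ε₀ ε₁ : ℝ} (hB₁ : 0 ≤ B₁) (hC₁ : 0 ≤ C₁) (hB₃ : 1 ≤ B₃) (hε₁ : 0 ≤ ε₁) :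
    B₁ * (ε₀ + C₁ * ε₁) ≤ B₁ * ε₀ + B₁ * C₁ * B₃ * ε₁ := by
  have h : B₁ * C₁ * ε₁ * 1 ≤ B₁ * C₁ * ε₁ * B₃ := mul_le_mul_of_nonneg_left hB₃ (by positivity)
  nlinarith

/-- «then the second condition above [2B₀C₁B₃ε₁ ≦ 8ε₂] is satisfied automatically» — because B₁ = 5dLB₀ ≥ B₀/4 (typed: B₀ ≤ 4B₁).
[cite: Balaban1985Variational, p.296 before (122)] -/
theorem second_condition_auto {B₀ B₁ B₃ C₁ ε₀ ε₁ : ℝ} (hB₁ : 0 ≤ B₁) (hC₁ : 0 ≤ C₁) (hB₃ : 0 ≤ B₃)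
    (hε₀ : 0 ≤ ε₀) (hε₁ : 0 ≤ ε₁) (hB₀B₁ : B₀ ≤ 4 * B₁) :
    2 * B₀ * C₁ * B₃ * ε₁ ≤ 8 * (B₁ * ε₀ + B₁ * C₁ * B₃ * ε₁) := by
  have h : B₀ * (C₁ * B₃ * ε₁) ≤ 4 * B₁ * (C₁ * B₃ * ε₁) := mul_le_mul_of_nonneg_right hB₀B₁ (by positivity)
  nlinarith

/-- **(122)** «To simplify them let us use the assumption B₃ε₁ ≦ ε₀. We have 8ε₂ ≦ 8B₁ε₀ + 8B₁C₁ε₀ ≦ 16B₁C₁ε₀» (for C₁ ≥ 1) — the tree's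
`B11.ineq122`, restated for the ε₂ of this file. [cite: Balaban1985Variational, (122) p.296] -/
theorem ineq122_le {B₁ B₃ C₁ ε₀ ε₁ : ℝ} (hB₁ : 0 ≤ B₁) (hC₁ : 1 ≤ C₁) (hε₀ : 0 ≤ ε₀) (h : B₃ * ε₁ ≤ ε₀) :
    8 * (B₁ * ε₀ + B₁ * C₁ * B₃ * ε₁) ≤ 16 * B₁ * C₁ * ε₀ :=
  ineq122 B₁ B₃ C₁ ε₀ ε₁ hB₁ hC₁ hε₀ h

/-- The silent restrictions carried by «ε₀ ≦ a₀»: with B₃ε₁ ≤ ε₀ and B₃, C₁ ≥ 1, [6] Thm 2's threshold (Prop. 2: ε₀ + C₁ε₁ ≤ c₁) follows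
from ε₀ ≤ c₁/(2C₁), and Prop. 5's «ε₃ sufficiently small» (ε₃ = 4ε₂ ≤ c) from ε₀ ≤ c/(8B₁C₁), by ε₀ + C₁ε₁ ≤ 2C₁ε₀ and 4ε₂ ≤ 8B₁C₁ε₀
((122) halved). [cite: Balaban1985Variational, (122) p.296] -/
theorem silent_restrictions {B₁ B₃ C₁ c₁ c ε₀ ε₁ : ℝ} (hB₁ : 0 < B₁) (hC₁ : 1 ≤ C₁) (hB₃ : 1 ≤ B₃) (hε₁ : 0 ≤ ε₁)
    (h : B₃ * ε₁ ≤ ε₀) (h₁ : ε₀ ≤ c₁ / (2 * C₁)) (h₂ : ε₀ ≤ c / (8 * B₁ * C₁)) :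
    ε₀ + C₁ * ε₁ ≤ c₁ ∧ 4 * (B₁ * ε₀ + B₁ * C₁ * B₃ * ε₁) ≤ c := by
  have hC₁pos : 0 < C₁ := by linarith
  have hε₁ε₀ : ε₁ ≤ ε₀ := by nlinarith
  have hε₀ : 0 ≤ ε₀ := le_trans (by positivity) h
  have h1' : ε₀ * (2 * C₁) ≤ c₁ := (le_div_iff₀ (by positivity)).1 h₁
  have h2' : ε₀ * (8 * B₁ * C₁) ≤ c := (le_div_iff₀ (by positivity)).1 h₂
  constructor
  · nlinarith
  · have h3 : B₁ * C₁ * (B₃ * ε₁) ≤ B₁ * C₁ * ε₀ := mul_le_mul_of_nonneg_left h (by positivity)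
    have h4 : B₁ * ε₀ * 1 ≤ B₁ * ε₀ * C₁ := mul_le_mul_of_nonneg_left hC₁ (by positivity)
    nlinarith

/-! ## §4 CLAUSE (i) of Proposition 7: at most one critical orbit in the space (6) -/

/-- **Proposition 7, clause (i), ASSEMBLED** (p. 296 «thus if B₃ε₁ ≦ ε₀ and 16B₁C₁ε₀ ≦ a₄, then the functional (5) has at most one
critical orbit in the space (6)» + p. 299).  For a family of variational problems `famP` bridged to its Sect. A–E descriptions `famD` with
the laws of §1: IF Propositions 2, 5, 6 hold for `famD` (typed statements of record, constants B₀, B₁, B₃, C₁, c₁ with B₃, C₁ ≥ 1,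
B₀ ≤ 4B₁), THEN there is a₀ > 0 — namely min{a₄/(16B₁C₁), c₁/(2C₁), c/(8B₁C₁)} from the constants a₄, c of Props 6, 5 — such that for
0 < ε₁, B₃ε₁ ≤ ε₀ ≤ a₀, every boundary datum V and every background U₀ with (14), the variational problem (5), (6) has at most one critical
orbit (`VarProblemX.AtMostOneCriticalOrbit ε₀ V`). [cite: Balaban1985Variational, Prop. 7 p.299; (122) p.296] -/
theorem atMostOneCriticalOrbit_of_props {famP : I → VarProblemX} {famD : I → LGData}
    (β : ∀ i, Bridge (famP i) (famD i)) {B₀ B₁ B₃ C₁ c₁ : ℝ} (laws : ∀ i, (β i).Laws C₁ B₃)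
    (hB₁ : 0 < B₁) (hB₃ : 1 ≤ B₃) (hC₁ : 1 ≤ C₁) (hB₀B₁ : B₀ ≤ 4 * B₁) (hc₁ : 0 < c₁)
    (h2 : Prop2Printed B₁ B₃ C₁ c₁ famD) (h5 : Prop5Printed B₁ B₃ C₁ famD) (h6 : Prop6Printed B₀ B₃ C₁ famD) :
    ∃ a₀ : ℝ, 0 < a₀ ∧ ∀ i : I, ∀ ε₀ ε₁ : ℝ, 0 < ε₁ → ε₀ ≤ a₀ → B₃ * ε₁ ≤ ε₀ →
      ∀ (V : (famP i).Bdry) (U₀ : (famD i).Cfg),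
        (famD i).Sat14 (C₁ * B₃ * ε₁) (C₁ * ε₁) ((β i).bdry V) U₀ → (famP i).AtMostOneCriticalOrbit ε₀ V := by
  obtain ⟨c, a₄, hc, ha₄, H⟩ := one_landau_of_props B₀ B₁ B₃ C₁ c₁ famD h2 h5 h6
  have hC₁pos : 0 < C₁ := by linarith
  set a₀ : ℝ := min (a₄ / (16 * B₁ * C₁)) (min (c₁ / (2 * C₁)) (c / (8 * B₁ * C₁))) with ha₀def
  have ha₀pos : 0 < a₀ := by
    simp only [ha₀def, lt_min_iff]
    exact ⟨by positivity, by positivity, by positivity⟩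
  refine ⟨a₀, ha₀pos, ?_⟩
  intro i ε₀ ε₁ hε₁ hε₀a hB₃ε V U₀ h14 U U'' hU hBU hcU hU'' hBU'' hcU''
  have hε₀ : 0 < ε₀ := lt_of_lt_of_le (by nlinarith) hB₃ε
  have ha4 : ε₀ ≤ a₄ / (16 * B₁ * C₁) := le_trans hε₀a (min_le_left _ _)
  have hc1 : ε₀ ≤ c₁ / (2 * C₁) := le_trans hε₀a (le_trans (min_le_right _ _) (min_le_left _ _))
  have hcc : ε₀ ≤ c / (8 * B₁ * C₁) := le_trans hε₀a (le_trans (min_le_right _ _) (min_le_right _ _))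
  obtain ⟨hsum, h4c⟩ := silent_restrictions hB₁ hC₁ hB₃ hε₁.le hB₃ε hc1 hcc
  -- ε₂ of p. 296
  set ε₂ : ℝ := B₁ * ε₀ + B₁ * C₁ * B₃ * ε₁ with hε₂def
  have hε₂ : B₁ * (ε₀ + C₁ * ε₁) ≤ ε₂ := eps2_ge_prop2 hB₁.le hC₁pos.le hB₃ hε₁.le
  have h8 : 8 * ε₂ ≤ a₄ := by
    have h122 := ineq122_le hB₁.le hC₁ hε₀.le hB₃ε
    have : ε₀ * (16 * B₁ * C₁) ≤ a₄ := (le_div_iff₀ (by positivity)).1 ha4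
    simp only [hε₂def]; nlinarith
  have h2B : 2 * B₀ * C₁ * B₃ * ε₁ ≤ 8 * ε₂ :=
    second_condition_auto hB₁.le hC₁pos.le (by linarith) hε₀.le hε₁.le hB₀B₁
  -- reduce both configurations to the space (18)
  obtain ⟨U', hU'18, hUorb, hUcrit⟩ := (laws i).gaugeFix ε₀ ε₁ V U₀ U h14 hU hBU
  obtain ⟨U''', hU''18, hU''orb, hU''crit⟩ := (laws i).gaugeFix ε₀ ε₁ V U₀ U'' h14 hU'' hBU''
  obtain ⟨U₁, u, u', hu, hu', hax, hax'⟩ :=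
    H i ε₀ ε₁ ε₂ hε₀ hε₁ hsum hB₃ε hε₂ h8 h2B h4c ((β i).bdry V) U₀ h14 U' U''' hU'18 (hUcrit hcU) hU''18 (hU''crit hcU'')
  have horb : (famP i).SameOrbit ((β i).emb U₀ U') ((β i).emb U₀ U''') := by
    have := (laws i).orbit16 U₀ U₁ u u' hu hu'
    rwa [hax, hax'] at this
  exact (laws i).trans _ _ _ hUorb ((laws i).trans _ _ _ horb ((laws i).symm _ _ hU''orb))

/-! ## §5 CLAUSE (ii) of Proposition 7: existence of a minimal orbit with ε₀ = O(1)C₁B₃ε₁ -/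

/-- The three located steps of the existence proof, pp. 296–299, as laws of the bridge with their constants O₁, O₂ (hypotheses, never
asserted).  `crit112` = p. 296 *"This solution determines a critical configuration U₁ by the transformation (112)"* + pp. 297–299
(123)–(140) *"Thus the transformation (47) applied to A′₁ yields the configuration … satisfying all the conditions (19)–(21) with ε₂ =
O(1)C₁B₃ε₁"*: the (112)-image of a solution of (111) in the space (115) with ε₄ = 3B₀C₁B₃ε₁ is a critical configuration of A(U₁U₀) in the
space (19)–(21) with ε₂ = O₁C₁B₃ε₁; `axial18` = p. 299 *"we apply to it a gauge transformation u … U_k = (U₁U₀)^u. Proposition 7 [6]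
implies that U_k belongs to the space (18) with ε₀ = O(1)C₁B₃ε₁ [read: O₂ε₂]. It is a critical configuration of the functional (5)"*;
`minimal142` = p. 299 (141)–(142) *"Hence A′ = 0 is a minimum … and this implies that U_k is a minimal configuration of the functional
A(U)"* (analytic core: `B11Eq142LocalMin`). [cite: Balaban1985Variational, pp.296–299, (112), (123)–(142)] -/
structure ExistenceLeaves {P : VarProblemX} {D : LGData} (β : Bridge P D) (B₀ B₃ C₁ O₁ O₂ : ℝ) : Prop where
  crit112 : ∀ (ε₁ : ℝ) (V : P.Bdry) (U₀ : D.Cfg) (A₁ : D.Fld), 0 < ε₁ →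
    D.Sat14 (C₁ * B₃ * ε₁) (C₁ * ε₁) (β.bdry V) U₀ → D.Sol111 (β.bdry V) U₀ A₁ → D.nMax U₀ A₁ < 3 * B₀ * C₁ * B₃ * ε₁ →
      D.CritL (β.bdry V) U₀ (D.T112 (β.bdry V) U₀ A₁) ∧
        D.In19_21 (O₁ * C₁ * B₃ * ε₁) (β.bdry V) U₀ (D.T112 (β.bdry V) U₀ A₁)
  axial18 : ∀ (ε₁ ε₂ : ℝ) (V : P.Bdry) (U₀ : D.Cfg) (U₁ : D.Pert),
    D.Sat14 (C₁ * B₃ * ε₁) (C₁ * ε₁) (β.bdry V) U₀ → D.In19_21 ε₂ (β.bdry V) U₀ U₁ → D.CritL (β.bdry V) U₀ U₁ →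
      ∃ u : D.GT, D.Restricted U₀ u ∧ P.InU (O₂ * ε₂) (β.emb U₀ (D.toAxial U₀ U₁ u)) ∧
        P.InB V (β.emb U₀ (D.toAxial U₀ U₁ u)) ∧ P.IsCritical V (β.emb U₀ (D.toAxial U₀ U₁ u))
  minimal142 : ∀ (e ε₁ : ℝ) (V : P.Bdry) (U₀ : D.Cfg) (U₁ : D.Pert) (u : D.GT),
    D.Sat14 (C₁ * B₃ * ε₁) (C₁ * ε₁) (β.bdry V) U₀ → D.CritL (β.bdry V) U₀ U₁ → D.Restricted U₀ u →
      P.InU e (β.emb U₀ (D.toAxial U₀ U₁ u)) → P.InB V (β.emb U₀ (D.toAxial U₀ U₁ u)) →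
        P.IsCritical V (β.emb U₀ (D.toAxial U₀ U₁ u)) → P.OnMinimalOrbit e V (β.emb U₀ (D.toAxial U₀ U₁ u))

/-- **Proposition 7, clause (ii), ASSEMBLED** («If ε₁ ≦ a′₁, then there exists a minimal orbit in the space (6) with ε₀ = O(1)C₁B₃ε₁»):
from `Prop6Printed` (the solution of (111) in (115), «if 2B₀C₁B₃ε₁ ≦ a₄») and the located steps `ExistenceLeaves`, with
a′₁ = a₄/(2B₀C₁B₃) and O(1) = O₂·O₁, for every V and every background U₀ with (14).
[cite: Balaban1985Variational, Prop. 7 p.299; p.296 after (122); p.299 before (141)] -/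
theorem exists_minimalOrbit_of_prop6 {famP : I → VarProblemX} {famD : I → LGData}
    (β : ∀ i, Bridge (famP i) (famD i)) {B₀ B₃ C₁ O₁ O₂ : ℝ} (leaves : ∀ i, ExistenceLeaves (β i) B₀ B₃ C₁ O₁ O₂)
    (hB₀ : 0 < B₀) (hB₃ : 0 < B₃) (hC₁ : 0 < C₁) (hO₁ : 0 < O₁) (hO₂ : 0 < O₂) (h6 : Prop6Printed B₀ B₃ C₁ famD) :
    ∃ a₁' O : ℝ, 0 < a₁' ∧ 0 < O ∧ ∀ i : I, ∀ ε₁ : ℝ, 0 < ε₁ → ε₁ ≤ a₁' →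
      ∀ (V : (famP i).Bdry) (U₀ : (famD i).Cfg), (famD i).Sat14 (C₁ * B₃ * ε₁) (C₁ * ε₁) ((β i).bdry V) U₀ →
        ∃ U : (famP i).Cfg, (famP i).OnMinimalOrbit (O * C₁ * B₃ * ε₁) V U := by
  obtain ⟨a₄, ha₄, H6⟩ := h6
  have hK : 0 < 2 * B₀ * C₁ * B₃ := by positivity
  refine ⟨a₄ / (2 * B₀ * C₁ * B₃), O₂ * O₁, div_pos ha₄ hK, mul_pos hO₂ hO₁, ?_⟩
  intro i ε₁ hε₁ hε₁a V U₀ h14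
  -- p. 296: «Equation (111) has a solution … with ε₄ = 2B₀C₁B₃ε₁, if 2B₀C₁B₃ε₁ ≦ a₄» — Prop. 6 at ε₄ = a₄
  have h2B : 2 * B₀ * C₁ * B₃ * ε₁ ≤ a₄ := by
    have := (le_div_iff₀ hK).1 hε₁a
    linarith
  obtain ⟨⟨A₁, _, hsol, hA₁, _⟩, _, _⟩ := H6 i ε₁ a₄ hε₁ le_rfl h2B ((β i).bdry V) U₀ h14
  -- pp. 296–299: the (112)-image is critical in (19)–(21) with ε₂ = O₁C₁B₃ε₁
  obtain ⟨hcritL, h19⟩ := (leaves i).crit112 ε₁ V U₀ A₁ hε₁ h14 hsol hA₁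
  -- p. 299: axial gauge, U_k ∈ (18) with ε₀ = O₂ε₂, critical for (5)
  obtain ⟨u, hu, hInU, hInB, hcrit⟩ :=
    (leaves i).axial18 ε₁ (O₁ * C₁ * B₃ * ε₁) V U₀ ((famD i).T112 ((β i).bdry V) U₀ A₁) h14 h19 hcritL
  -- p. 299 (141)–(142): minimal
  have hmin := (leaves i).minimal142 (O₂ * (O₁ * C₁ * B₃ * ε₁)) ε₁ V U₀ ((famD i).T112 ((β i).bdry V) U₀ A₁) u
    h14 hcritL hu hInU hInB hcrit
  have hO : O₂ * O₁ * C₁ * B₃ * ε₁ = O₂ * (O₁ * C₁ * B₃ * ε₁) := by ring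
  rw [hO]
  exact ⟨_, hmin⟩

/-! ## §6 Proposition 7 assembled: the background-dependent form and the typed statement of record -/

/-- **Proposition 7 from Propositions 2, 5, 6 — background-dependent form** (the shape of `B11Thm1.Prop7From14`: at level k the background
U₀ of (14) is supplied by Theorem 1 at level k − 1, (12)–(14) p. 280): for every bridged family with the laws of §1 and the located leaves of
§5, `Prop2Printed ∧ Prop5Printed ∧ Prop6Printed` ⇒ constants a₀, a′₁, O(1) > 0 such that for every V with (7) and every U₀ with (14):
(ε₀ ≤ a₀ ∧ B₃ε₁ ≤ ε₀ ⇒ at most one critical orbit in (6)) ∧ (ε₁ ≤ a′₁ ⇒ a minimal orbit in (6) with ε₀ = O(1)C₁B₃ε₁).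
[cite: Balaban1985Variational, Prop. 7 p.299] -/
theorem prop7From14_of_props {famP : I → VarProblemX} {famD : I → LGData}
    (β : ∀ i, Bridge (famP i) (famD i)) {B₀ B₁ B₃ C₁ c₁ O₁ O₂ : ℝ} (laws : ∀ i, (β i).Laws C₁ B₃)
    (leaves : ∀ i, ExistenceLeaves (β i) B₀ B₃ C₁ O₁ O₂)
    (hB₀ : 0 < B₀) (hB₁ : 0 < B₁) (hB₃ : 1 ≤ B₃) (hC₁ : 1 ≤ C₁) (hB₀B₁ : B₀ ≤ 4 * B₁) (hc₁ : 0 < c₁)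
    (hO₁ : 0 < O₁) (hO₂ : 0 < O₂)
    (h2 : Prop2Printed B₁ B₃ C₁ c₁ famD) (h5 : Prop5Printed B₁ B₃ C₁ famD) (h6 : Prop6Printed B₀ B₃ C₁ famD) :
    ∃ a₀ a₁' O : ℝ, 0 < a₀ ∧ 0 < a₁' ∧ 0 < O ∧
      ∀ i : I, ∀ ε₀ ε₁ : ℝ, 0 < ε₁ → ∀ V : (famP i).Bdry, (famP i).Reg7 ε₁ V →
        ∀ U₀ : (famD i).Cfg, (famD i).Sat14 (C₁ * B₃ * ε₁) (C₁ * ε₁) ((β i).bdry V) U₀ →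
          (ε₀ ≤ a₀ → B₃ * ε₁ ≤ ε₀ → (famP i).AtMostOneCriticalOrbit ε₀ V) ∧
          (ε₁ ≤ a₁' → ∃ U : (famP i).Cfg, (famP i).OnMinimalOrbit (O * C₁ * B₃ * ε₁) V U) := by
  obtain ⟨a₀, ha₀, HU⟩ := atMostOneCriticalOrbit_of_props β laws hB₁ hB₃ hC₁ hB₀B₁ hc₁ h2 h5 h6
  obtain ⟨a₁', O, ha₁', hO, HE⟩ :=
    exists_minimalOrbit_of_prop6 β leaves hB₀ (by linarith) (by linarith) hO₁ hO₂ h6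
  refine ⟨a₀, a₁', O, ha₀, ha₁', hO, fun i ε₀ ε₁ hε₁ V _ U₀ h14 => ⟨?_, ?_⟩⟩
  · exact fun hε₀a hB₃ε => HU i ε₀ ε₁ hε₁ hε₀a hB₃ε V U₀ h14
  · exact fun hε₁a => HE i ε₁ hε₁ hε₁a V U₀ h14

/-- **The typed statement of record `B11.Prop7Printed B₃ C₁ famP`** for every bridged family satisfying Propositions 2, 5, 6 (typed
statements of record on the Sect. A–E carriers), the laws of §1, the located leaves of §5, and the Sect. A law «every V with (7) admits a
background U₀ with (14)» (p. 280 (12)–(14): Theorem 1 at level k − 1 transported by (11)–(13), and U₀ = V₀ for k = 1; cell GAPS G-pv12-1 —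
the same residual hypothesis as `B11Thm1.prop7Printed_of_from14`). [cite: Balaban1985Variational, Prop. 7 p.299; (12)–(14) p.280] -/
theorem prop7Printed_of_props {famP : I → VarProblemX} {famD : I → LGData}
    (β : ∀ i, Bridge (famP i) (famD i)) {B₀ B₁ B₃ C₁ c₁ O₁ O₂ : ℝ} (laws : ∀ i, (β i).Laws C₁ B₃)
    (leaves : ∀ i, ExistenceLeaves (β i) B₀ B₃ C₁ O₁ O₂)
    (hB₀ : 0 < B₀) (hB₁ : 0 < B₁) (hB₃ : 1 ≤ B₃) (hC₁ : 1 ≤ C₁) (hB₀B₁ : B₀ ≤ 4 * B₁) (hc₁ : 0 < c₁)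
    (hO₁ : 0 < O₁) (hO₂ : 0 < O₂)
    (h2 : Prop2Printed B₁ B₃ C₁ c₁ famD) (h5 : Prop5Printed B₁ B₃ C₁ famD) (h6 : Prop6Printed B₀ B₃ C₁ famD)
    (hbg : ∀ (i : I) (ε₁ : ℝ) (V : (famP i).Bdry), 0 < ε₁ → (famP i).Reg7 ε₁ V →
      ∃ U₀ : (famD i).Cfg, (famD i).Sat14 (C₁ * B₃ * ε₁) (C₁ * ε₁) ((β i).bdry V) U₀) :
    Prop7Printed B₃ C₁ famP := by
  obtain ⟨a₀, a₁', O, ha₀, ha₁', hO, H⟩ :=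
    prop7From14_of_props β laws leaves hB₀ hB₁ hB₃ hC₁ hB₀B₁ hc₁ hO₁ hO₂ h2 h5 h6
  refine ⟨a₀, a₁', O, ha₀, ha₁', hO, fun i ε₀ ε₁ hε₁ V hV => ?_⟩
  obtain ⟨U₀, h14⟩ := hbg i ε₁ V hε₁ hV
  exact H i ε₀ ε₁ hε₁ V hV U₀ h14

/-- The chain one level up, BY NAME: with Proposition 8 and the Sect. F conclusion (typed statements of record) and the carrier dictionary
`VarProblemX.Laws`, Theorem 1 as printed follows (`B11.thm1_of_prop7_prop8_sectF`) — so `Thm1Printed ⇐ Props 2, 5, 6, 8, Sect. F` modulo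
the located leaves, for every bridged family. [cite: Balaban1985Variational, Thm 1 p.279, p.304 «Now we define a₁ …»] -/
theorem thm1Printed_of_props {famP : I → VarProblemX} {famD : I → LGData}
    (β : ∀ i, Bridge (famP i) (famD i)) {B₀ B₁ B₃ C₁ c₁ O₁ O₂ : ℝ} (laws : ∀ i, (β i).Laws C₁ B₃)
    (leaves : ∀ i, ExistenceLeaves (β i) B₀ B₃ C₁ O₁ O₂) (plaws : ∀ i, (famP i).Laws)
    (hB₀ : 0 < B₀) (hB₁ : 0 < B₁) (hB₃ : 1 ≤ B₃) (hC₁ : 1 ≤ C₁) (hB₀B₁ : B₀ ≤ 4 * B₁) (hc₁ : 0 < c₁)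
    (hO₁ : 0 < O₁) (hO₂ : 0 < O₂)
    (h2 : Prop2Printed B₁ B₃ C₁ c₁ famD) (h5 : Prop5Printed B₁ B₃ C₁ famD) (h6 : Prop6Printed B₀ B₃ C₁ famD)
    (hbg : ∀ (i : I) (ε₁ : ℝ) (V : (famP i).Bdry), 0 < ε₁ → (famP i).Reg7 ε₁ V →
      ∃ U₀ : (famD i).Cfg, (famD i).Sat14 (C₁ * B₃ * ε₁) (C₁ * ε₁) ((β i).bdry V) U₀)
    (h8 : Prop8Printed B₃ famP) (hF : SectFPrinted B₃ famP) :
    Thm1Printed (fun i => (famP i).toVarProblem) :=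
  thm1_of_prop7_prop8_sectF famP B₃ C₁ (by linarith) (by linarith) plaws
    (prop7Printed_of_props β laws leaves hB₀ hB₁ hB₃ hC₁ hB₀B₁ hc₁ hO₁ hO₂ h2 h5 h6 hbg) h8 hF


/-! ## §7 (v1.1) The minimality leaf with a radius cap -/

/-- **The located existence leaves with a RADIUS CAP on the minimality step** (v1.1).  `crit112` and `axial18` exactly as in `ExistenceLeaves`;
`minimal142` only for spaces 𝔘(e) with `e ≤ e₅`: p. 299 (141)–(142) *"Hence A′ = 0 is a minimum … and this implies that U_k is a minimal
configuration"* is argued for THE configuration U_k in the space (6) with ε₀ = O(1)C₁B₃ε₁ (small), cf. p. 301 *"a sufficiently small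
neighborhood"*; as a law over all e the uncapped field would make every critical configuration of every 𝔘(e) minimal.  In the one-norm chart
model (`B11Prop7Model`) the capped law holds with e₅ = min{a₃/2, γ/(8C₄)}.  Hypotheses of the theorems below, never asserted.
[cite: Balaban1985Variational, (112) p.294, (123)–(142) pp.296–299, p.301] -/
structure ExistenceLeavesCap {P : VarProblemX} {D : LGData} (β : Bridge P D) (B₀ B₃ C₁ O₁ O₂ e₅ : ℝ) : Prop where
  crit112 : ∀ (ε₁ : ℝ) (V : P.Bdry) (U₀ : D.Cfg) (A₁ : D.Fld), 0 < ε₁ →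
    D.Sat14 (C₁ * B₃ * ε₁) (C₁ * ε₁) (β.bdry V) U₀ → D.Sol111 (β.bdry V) U₀ A₁ → D.nMax U₀ A₁ < 3 * B₀ * C₁ * B₃ * ε₁ →
      D.CritL (β.bdry V) U₀ (D.T112 (β.bdry V) U₀ A₁) ∧
        D.In19_21 (O₁ * C₁ * B₃ * ε₁) (β.bdry V) U₀ (D.T112 (β.bdry V) U₀ A₁)
  axial18 : ∀ (ε₁ ε₂ : ℝ) (V : P.Bdry) (U₀ : D.Cfg) (U₁ : D.Pert),
    D.Sat14 (C₁ * B₃ * ε₁) (C₁ * ε₁) (β.bdry V) U₀ → D.In19_21 ε₂ (β.bdry V) U₀ U₁ → D.CritL (β.bdry V) U₀ U₁ →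
      ∃ u : D.GT, D.Restricted U₀ u ∧ P.InU (O₂ * ε₂) (β.emb U₀ (D.toAxial U₀ U₁ u)) ∧
        P.InB V (β.emb U₀ (D.toAxial U₀ U₁ u)) ∧ P.IsCritical V (β.emb U₀ (D.toAxial U₀ U₁ u))
  minimal142 : ∀ (e ε₁ : ℝ) (V : P.Bdry) (U₀ : D.Cfg) (U₁ : D.Pert) (u : D.GT), e ≤ e₅ →
    D.Sat14 (C₁ * B₃ * ε₁) (C₁ * ε₁) (β.bdry V) U₀ → D.CritL (β.bdry V) U₀ U₁ → D.Restricted U₀ u →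
      P.InU e (β.emb U₀ (D.toAxial U₀ U₁ u)) → P.InB V (β.emb U₀ (D.toAxial U₀ U₁ u)) →
        P.IsCritical V (β.emb U₀ (D.toAxial U₀ U₁ u)) → P.OnMinimalOrbit e V (β.emb U₀ (D.toAxial U₀ U₁ u))

/-- The uncapped leaves imply the capped ones for every cap. [cite: Balaban1985Variational, pp.296–299] -/
theorem ExistenceLeaves.cap {P : VarProblemX} {D : LGData} {β : Bridge P D} {B₀ B₃ C₁ O₁ O₂ : ℝ}
    (h : ExistenceLeaves β B₀ B₃ C₁ O₁ O₂) (e₅ : ℝ) : ExistenceLeavesCap β B₀ B₃ C₁ O₁ O₂ e₅ where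
  crit112 := h.crit112
  axial18 := h.axial18
  minimal142 := fun e ε₁ V U₀ U₁ u _ => h.minimal142 e ε₁ V U₀ U₁ u

/-- **Proposition 7, clause (ii), ASSEMBLED with the capped leaves**: from `Prop6Printed` and `ExistenceLeavesCap`, with
a′₁ = min{a₄/(2B₀C₁B₃), e₅/(O₂O₁C₁B₃)} (the second member puts the space (6) with ε₀ = O(1)C₁B₃ε₁ inside the cap) and O(1) = O₂·O₁.
[cite: Balaban1985Variational, Prop. 7 p.299; p.296 after (122); p.299 before (141)] -/
theorem exists_minimalOrbit_of_prop6_cap {famP : I → VarProblemX} {famD : I → LGData}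
    (β : ∀ i, Bridge (famP i) (famD i)) {B₀ B₃ C₁ O₁ O₂ e₅ : ℝ} (leaves : ∀ i, ExistenceLeavesCap (β i) B₀ B₃ C₁ O₁ O₂ e₅)
    (hB₀ : 0 < B₀) (hB₃ : 0 < B₃) (hC₁ : 0 < C₁) (hO₁ : 0 < O₁) (hO₂ : 0 < O₂) (he₅ : 0 < e₅)
    (h6 : Prop6Printed B₀ B₃ C₁ famD) :
    ∃ a₁' O : ℝ, 0 < a₁' ∧ 0 < O ∧ ∀ i : I, ∀ ε₁ : ℝ, 0 < ε₁ → ε₁ ≤ a₁' →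
      ∀ (V : (famP i).Bdry) (U₀ : (famD i).Cfg), (famD i).Sat14 (C₁ * B₃ * ε₁) (C₁ * ε₁) ((β i).bdry V) U₀ →
        ∃ U : (famP i).Cfg, (famP i).OnMinimalOrbit (O * C₁ * B₃ * ε₁) V U := by
  obtain ⟨a₄, ha₄, H6⟩ := h6
  have hK : 0 < 2 * B₀ * C₁ * B₃ := by positivity
  have hK' : 0 < O₂ * O₁ * C₁ * B₃ := by positivity
  refine ⟨min (a₄ / (2 * B₀ * C₁ * B₃)) (e₅ / (O₂ * O₁ * C₁ * B₃)), O₂ * O₁,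
    lt_min (div_pos ha₄ hK) (div_pos he₅ hK'), mul_pos hO₂ hO₁, ?_⟩
  intro i ε₁ hε₁ hε₁a V U₀ h14
  -- p. 296: Prop. 6 at ε₄ = a₄, «if 2B₀C₁B₃ε₁ ≦ a₄»
  have h2B : 2 * B₀ * C₁ * B₃ * ε₁ ≤ a₄ := by
    have := (le_div_iff₀ hK).1 (hε₁a.trans (min_le_left _ _))
    linarith
  -- the cap: O₂O₁C₁B₃ε₁ ≤ e₅
  have hcap : O₂ * (O₁ * C₁ * B₃ * ε₁) ≤ e₅ := by
    have := (le_div_iff₀ hK').1 (hε₁a.trans (min_le_right _ _))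
    linarith
  obtain ⟨⟨A₁, _, hsol, hA₁, _⟩, _, _⟩ := H6 i ε₁ a₄ hε₁ le_rfl h2B ((β i).bdry V) U₀ h14
  obtain ⟨hcritL, h19⟩ := (leaves i).crit112 ε₁ V U₀ A₁ hε₁ h14 hsol hA₁
  obtain ⟨u, hu, hInU, hInB, hcrit⟩ :=
    (leaves i).axial18 ε₁ (O₁ * C₁ * B₃ * ε₁) V U₀ ((famD i).T112 ((β i).bdry V) U₀ A₁) h14 h19 hcritL
  have hmin := (leaves i).minimal142 (O₂ * (O₁ * C₁ * B₃ * ε₁)) ε₁ V U₀ ((famD i).T112 ((β i).bdry V) U₀ A₁) u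
    hcap h14 hcritL hu hInU hInB hcrit
  have hO : O₂ * O₁ * C₁ * B₃ * ε₁ = O₂ * (O₁ * C₁ * B₃ * ε₁) := by ring
  rw [hO]
  exact ⟨_, hmin⟩

/-- **Proposition 7 from Propositions 2, 5, 6 with the capped leaves — background-dependent form** (shape of `B11Thm1.Prop7From14`).
[cite: Balaban1985Variational, Prop. 7 p.299] -/
theorem prop7From14_of_props_cap {famP : I → VarProblemX} {famD : I → LGData}
    (β : ∀ i, Bridge (famP i) (famD i)) {B₀ B₁ B₃ C₁ c₁ O₁ O₂ e₅ : ℝ} (laws : ∀ i, (β i).Laws C₁ B₃)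
    (leaves : ∀ i, ExistenceLeavesCap (β i) B₀ B₃ C₁ O₁ O₂ e₅)
    (hB₀ : 0 < B₀) (hB₁ : 0 < B₁) (hB₃ : 1 ≤ B₃) (hC₁ : 1 ≤ C₁) (hB₀B₁ : B₀ ≤ 4 * B₁) (hc₁ : 0 < c₁)
    (hO₁ : 0 < O₁) (hO₂ : 0 < O₂) (he₅ : 0 < e₅)
    (h2 : Prop2Printed B₁ B₃ C₁ c₁ famD) (h5 : Prop5Printed B₁ B₃ C₁ famD) (h6 : Prop6Printed B₀ B₃ C₁ famD) :
    ∃ a₀ a₁' O : ℝ, 0 < a₀ ∧ 0 < a₁' ∧ 0 < O ∧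
      ∀ i : I, ∀ ε₀ ε₁ : ℝ, 0 < ε₁ → ∀ V : (famP i).Bdry, (famP i).Reg7 ε₁ V →
        ∀ U₀ : (famD i).Cfg, (famD i).Sat14 (C₁ * B₃ * ε₁) (C₁ * ε₁) ((β i).bdry V) U₀ →
          (ε₀ ≤ a₀ → B₃ * ε₁ ≤ ε₀ → (famP i).AtMostOneCriticalOrbit ε₀ V) ∧
          (ε₁ ≤ a₁' → ∃ U : (famP i).Cfg, (famP i).OnMinimalOrbit (O * C₁ * B₃ * ε₁) V U) := by
  obtain ⟨a₀, ha₀, HU⟩ := atMostOneCriticalOrbit_of_props β laws hB₁ hB₃ hC₁ hB₀B₁ hc₁ h2 h5 h6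
  obtain ⟨a₁', O, ha₁', hO, HE⟩ :=
    exists_minimalOrbit_of_prop6_cap β leaves hB₀ (by linarith) (by linarith) hO₁ hO₂ he₅ h6
  refine ⟨a₀, a₁', O, ha₀, ha₁', hO, fun i ε₀ ε₁ hε₁ V _ U₀ h14 => ⟨?_, ?_⟩⟩
  · exact fun hε₀a hB₃ε => HU i ε₀ ε₁ hε₁ hε₀a hB₃ε V U₀ h14
  · exact fun hε₁a => HE i ε₁ hε₁ hε₁a V U₀ h14

/-- **The typed statement of record `B11.Prop7Printed B₃ C₁ famP` with the capped leaves** (as `prop7Printed_of_props`, plus the Sect. A law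
«every V with (7) admits a background U₀ with (14)»). [cite: Balaban1985Variational, Prop. 7 p.299; (12)–(14) p.280] -/
theorem prop7Printed_of_props_cap {famP : I → VarProblemX} {famD : I → LGData}
    (β : ∀ i, Bridge (famP i) (famD i)) {B₀ B₁ B₃ C₁ c₁ O₁ O₂ e₅ : ℝ} (laws : ∀ i, (β i).Laws C₁ B₃)
    (leaves : ∀ i, ExistenceLeavesCap (β i) B₀ B₃ C₁ O₁ O₂ e₅)
    (hB₀ : 0 < B₀) (hB₁ : 0 < B₁) (hB₃ : 1 ≤ B₃) (hC₁ : 1 ≤ C₁) (hB₀B₁ : B₀ ≤ 4 * B₁) (hc₁ : 0 < c₁)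
    (hO₁ : 0 < O₁) (hO₂ : 0 < O₂) (he₅ : 0 < e₅)
    (h2 : Prop2Printed B₁ B₃ C₁ c₁ famD) (h5 : Prop5Printed B₁ B₃ C₁ famD) (h6 : Prop6Printed B₀ B₃ C₁ famD)
    (hbg : ∀ (i : I) (ε₁ : ℝ) (V : (famP i).Bdry), 0 < ε₁ → (famP i).Reg7 ε₁ V →
      ∃ U₀ : (famD i).Cfg, (famD i).Sat14 (C₁ * B₃ * ε₁) (C₁ * ε₁) ((β i).bdry V) U₀) :
    Prop7Printed B₃ C₁ famP := by
  obtain ⟨a₀, a₁', O, ha₀, ha₁', hO, H⟩ :=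
    prop7From14_of_props_cap β laws leaves hB₀ hB₁ hB₃ hC₁ hB₀B₁ hc₁ hO₁ hO₂ he₅ h2 h5 h6
  refine ⟨a₀, a₁', O, ha₀, ha₁', hO, fun i ε₀ ε₁ hε₁ V hV => ?_⟩
  obtain ⟨U₀, h14⟩ := hbg i ε₁ V hε₁ hV
  exact H i ε₀ ε₁ hε₁ V hV U₀ h14

/-- The chain one level up with the capped leaves, BY NAME (`B11.thm1_of_prop7_prop8_sectF`). [cite: Balaban1985Variational, Thm 1 p.279] -/
theorem thm1Printed_of_props_cap {famP : I → VarProblemX} {famD : I → LGData}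
    (β : ∀ i, Bridge (famP i) (famD i)) {B₀ B₁ B₃ C₁ c₁ O₁ O₂ e₅ : ℝ} (laws : ∀ i, (β i).Laws C₁ B₃)
    (leaves : ∀ i, ExistenceLeavesCap (β i) B₀ B₃ C₁ O₁ O₂ e₅) (plaws : ∀ i, (famP i).Laws)
    (hB₀ : 0 < B₀) (hB₁ : 0 < B₁) (hB₃ : 1 ≤ B₃) (hC₁ : 1 ≤ C₁) (hB₀B₁ : B₀ ≤ 4 * B₁) (hc₁ : 0 < c₁)
    (hO₁ : 0 < O₁) (hO₂ : 0 < O₂) (he₅ : 0 < e₅)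
    (h2 : Prop2Printed B₁ B₃ C₁ c₁ famD) (h5 : Prop5Printed B₁ B₃ C₁ famD) (h6 : Prop6Printed B₀ B₃ C₁ famD)
    (hbg : ∀ (i : I) (ε₁ : ℝ) (V : (famP i).Bdry), 0 < ε₁ → (famP i).Reg7 ε₁ V →
      ∃ U₀ : (famD i).Cfg, (famD i).Sat14 (C₁ * B₃ * ε₁) (C₁ * ε₁) ((β i).bdry V) U₀)
    (h8 : Prop8Printed B₃ famP) (hF : SectFPrinted B₃ famP) :
    Thm1Printed (fun i => (famP i).toVarProblem) :=
  thm1_of_prop7_prop8_sectF famP B₃ C₁ (by linarith) (by linarith) plaws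
    (prop7Printed_of_props_cap β laws leaves hB₀ hB₁ hB₃ hC₁ hB₀B₁ hc₁ hO₁ hO₂ he₅ h2 h5 h6 hbg) h8 hF

end Literature.MathematicalPhysics.QuantumFieldTheory.Balaban1983to89.B11Prop7Assembly
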